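import Literature.Analysis.Fourier.HilbertTransformCircleSeries
import Literature.Analysis.FluidPDE.OkamotoSakajoWunsch2008.FourierEval
import Literature.Analysis.FluidPDE.OkamotoSakajoWunsch2008.DissipativeCircle
import HarnessLib

/-!
# OSW 2008 / separable blow-up: the Fourier MULTIPLIER `−i·sgn k` of the typed target IS the analytic
# periodic Hilbert transform — the profile equation and eq. (3) hold with the genuine p.v. operator

HONEST FRAMING (cells pub-oswblow / ns-blowup): **1-D model (gCLM/OSW), computer-assisted context; not Euler/NS.**

`SeparableBlowup.lean` types the Okamoto–Sakajo–Wunsch equation [cite: OkamotoSakajoWunsch2008, eq. (3)] and the cell's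
target `AnalyticSeparableProfile` entirely on the FOURIER SIDE («Design (why no theory of the periodic Hilbert transform is
needed)»): `Hω` is the coefficient sequence `hilbertCoeff c k = −i·sgn(k)·c_k`, read pointwise through `fourierEval`.
The analytic operator now exists in the tree — `Literature.Analysis.Fourier.hilbertTransformCircle`
(`Hf(x) = (2π)⁻¹ ∫₀^π (f(x−t) − f(x+t)) cot(t/2) dt`, `HilbertTransformCircle.lean`), acting termwise on every trigonometric series
with a finite first moment (`hilbertTransformCircle_tsum`, `HilbertTransformCircleSeries.lean`). This file closes the gap between
the two spellings for the class the target quantifies over (exponentially decaying, real coefficient sequences):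

* `hilbertTransformCircle_fourierEval_re` — for `ExpDecay c ρ K` and `IsRealSeq c`,
  `hilbertTransformCircle (fun x => (fourierEval c x).re) x = (fourierEval (hilbertCoeff c) x).re` at every `x`
  [cite: Grafakos2014, Ex. 4.1.4(c) (the conjugate function acts as `−i sgn k` on Fourier coefficients)];
  proof: fold the `ℤ`-series into `Re c₀ + Σ_{k≥1} 2 Re(c_k e^{ikx})` (pairing `±k`, `c_{−k} = conj c_k`) and apply
  `hilbertTransformCircle_tsum`;
* consequences for the typed objects of `SeparableBlowup.lean` (no new definition, nothing asserted about existence):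
  the real profile `f = Re ∘ fourierEval c` of an `IsSeparableProfile a c` satisfies the profile equation (T1)
  `f = −a·g·f′ + f·Hf` of [cite: LushnikovSilantyevSiegel2021, §11] with `H = hilbertTransformCircle`, `f′ = Re ∘ fourierEval (derivCoeff c)`
  its derivative and `g = Re ∘ velocityEval c` a primitive of `Hf` (`profileEq_re_of_isSeparableProfile`, `hasDerivAt_fourierEval_re`,
  `hasDerivAt_velocityEval_re`); a typed `IsClassicalSolution a C T` is a classical solution of eq. (3) with the genuine Hilbert
  transform (`hasDerivAt_re_of_isClassicalSolution`); and `AnalyticSeparableProfile P lo hi` yields real functions `f, f′, g` with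
  exactly the hypotheses shape of the E2 analytic step (`Summits/…/OSWSelfSimilar/OSWAprioriAnalyticStep.lean`)
  (`analyticSeparableProfile_real`).

So a certified Fourier-side rung (`QuantisedFamily.lean`, `CertificateFamily*.lean`) and the corollary
`osw_blowup_from_analytic_data` are statements about the OSW equation with the ANALYTIC `H`, not only about its multiplier
transcription. No definitions; no named facts.
-/

noncomputable section

namespace Literature.Analysis.Fourier

open _root_.MeasureTheory

/-- Adding a constant does not change the periodic Hilbert transform: the symmetric p.v. integrand only sees
`f(x−t) − f(x+t)` (no integrability needed; cf. `hilbertTransformCircle_const`). [cite: Grafakos2014, Ex. 4.1.4(c)] -/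
theorem hilbertTransformCircle_const_add (a : ℝ) (f : ℝ → ℝ) (x : ℝ) :
    hilbertTransformCircle (fun y => a + f y) x = hilbertTransformCircle f x := by
  unfold hilbertTransformCircle
  simp only [add_sub_add_left_eq_sub]

end Literature.Analysis.Fourier

namespace Literature.Analysis.FluidPDE.OkamotoSakajoWunsch2008

open _root_.Complex _root_.Filter _root_.Set Literature.Analysis.Fourier
open scoped Real Topology

/-! ### Real and imaginary parts of the characters and of the terms -/

/-- `Re e^{ikx} = cos(kx)` (helper). [folklore] -/
private theorem expChar_re (k : ℤ) (x : ℝ) : (expChar k x).re = Real.cos (k * x) := by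
  rw [expChar_eq]
  exact Complex.exp_ofReal_mul_I_re _

/-- `Im e^{ikx} = sin(kx)` (helper). [folklore] -/
private theorem expChar_im (k : ℤ) (x : ℝ) : (expChar k x).im = Real.sin (k * x) := by
  rw [expChar_eq]
  exact Complex.exp_ofReal_mul_I_im _

/-- `Re (z e^{ikx}) = Re z · cos(kx) − Im z · sin(kx)` (helper). [folklore] -/
private theorem re_mul_expChar (z : ℂ) (k : ℤ) (x : ℝ) :
    (z * expChar k x).re = z.re * Real.cos (k * x) - z.im * Real.sin (k * x) := by
  rw [Complex.mul_re, expChar_re, expChar_im]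

/-- For a real coefficient sequence the `(−k)`-th term of the Fourier series is the conjugate of the `k`-th (helper). [folklore] -/
private theorem term_neg_of_isRealSeq {c : ℤ → ℂ} (hre : IsRealSeq c) (k : ℤ) (x : ℝ) :
    c (-k) * expChar (-k) x = (starRingEnd ℂ) (c k * expChar k x) := by
  rw [map_mul, conj_expChar, hre k]

/-- `e^{ik(x + 2π)} = e^{ikx}` (helper). [folklore] -/
private theorem expChar_add_two_pi (k : ℤ) (x : ℝ) : expChar k (x + 2 * π) = expChar k x := by
  unfold expChar
  have h : Complex.I * (k : ℂ) * ((x + 2 * π : ℝ) : ℂ) = Complex.I * (k : ℂ) * (x : ℂ) + (k : ℂ) * (2 * π * Complex.I) := by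
    push_cast
    ring
  rw [h, Complex.exp_add, Complex.exp_int_mul_two_pi_mul_I, mul_one]

/-- The Fourier series `fourierEval c` is `2π`-periodic in `x` — the «periodic boundary condition on `−π < x < π`» of the setting
(no summability needed). [cite: OkamotoSakajoWunsch2008, §1] -/
theorem fourierEval_add_two_pi (c : ℤ → ℂ) (x : ℝ) : fourierEval c (x + 2 * π) = fourierEval c x := by
  unfold fourierEval
  simp_rw [expChar_add_two_pi]

/-! ### Folding the `ℤ`-series of a real sequence into a cosine/sine series over `k ≥ 1` -/

/-- **Folding.** For an exponentially decaying REAL coefficient sequence (`c_{−k} = conj c_k`, the real-valuedness of the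
`2π`-periodic vorticity represented as `Σ_k ĉ_k e^{ikx}`), `Re f(x) − Re c₀ = Σ_{k ≥ 0} 2·Re(c_{k+1} e^{i(k+1)x})` as a convergent series
over `ℕ` (pair the terms `±k`; the `(−k)`-th term is the conjugate of the `k`-th).
[cite: LushnikovSilantyevSiegel2021, §8 (Fourier representation `ω = Σ_k ω̂_k e^{ikq}` of the real-valued periodic solution)] -/
theorem hasSum_re_fourierEval {c : ℤ → ℂ} {ρ K : ℝ} (h : ExpDecay c ρ K) (hre : IsRealSeq c) (x : ℝ) :
    HasSum (fun k : ℕ => 2 * (c ((k + 1 : ℕ) : ℤ) * expChar ((k + 1 : ℕ) : ℤ) x).re)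
      ((fourierEval c x).re - (c 0).re) := by
  have hsum : HasSum (fun k : ℤ => c k * expChar k x) (fourierEval c x) := (h.summable_term x).hasSum
  have h1 : HasSum (fun n : ℕ => c n * expChar n x + c (-(n : ℤ)) * expChar (-(n : ℤ)) x)
      (fourierEval c x + c 0 * expChar 0 x) := hsum.nat_add_neg
  have h2 := Complex.hasSum_re h1
  have hF0 : c 0 * expChar 0 x = c 0 := by simp [expChar]
  have hfun : (fun n : ℕ => (c n * expChar n x + c (-(n : ℤ)) * expChar (-(n : ℤ)) x).re) =
      fun n : ℕ => 2 * (c n * expChar n x).re := by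
    funext n
    rw [term_neg_of_isRealSeq hre, Complex.add_re, Complex.conj_re]
    ring
  rw [hfun, hF0, Complex.add_re] at h2
  have h3 := (hasSum_nat_add_iff' (f := fun n : ℕ => 2 * (c n * expChar n x).re) 1).mpr h2
  have key : (fourierEval c x).re - (c 0).re
      = (fourierEval c x).re + (c 0).re - ∑ i ∈ Finset.range 1, 2 * (c (i : ℕ) * expChar (i : ℕ) x).re := by
    rw [Finset.sum_range_one, Nat.cast_zero, hF0]
    ring
  rw [key]
  exact h3

/-- The same folding written with cosines and sines: `Re f(x) − Re c₀ = Σ_{k≥0} (α_k sin((k+1)x) + β_k cos((k+1)x))` with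
`α_k = −2 Im c_{k+1}`, `β_k = 2 Re c_{k+1}` (real form of the Fourier series of a real-valued periodic function).
[cite: LushnikovSilantyevSiegel2021, §8 (Fourier representation of the real-valued periodic solution)] -/
theorem hasSum_re_fourierEval_trig {c : ℤ → ℂ} {ρ K : ℝ} (h : ExpDecay c ρ K) (hre : IsRealSeq c) (x : ℝ) :
    HasSum (fun k : ℕ => -2 * (c ((k + 1 : ℕ) : ℤ)).im * Real.sin (((k + 1 : ℕ) : ℝ) * x)
        + 2 * (c ((k + 1 : ℕ) : ℤ)).re * Real.cos (((k + 1 : ℕ) : ℝ) * x))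
      ((fourierEval c x).re - (c 0).re) := by
  convert hasSum_re_fourierEval h hre x using 1
  funext k
  rw [re_mul_expChar]
  push_cast
  ring

/-- Hence `Re f = Re c₀ + Σ_{k≥0} (α_k sin((k+1)·) + β_k cos((k+1)·))` pointwise, as a `tsum` (real form of the Fourier series of a
real-valued periodic function). [cite: LushnikovSilantyevSiegel2021, §8 (Fourier representation of the real-valued periodic solution)] -/
theorem fourierEval_re_eq_const_add_tsum {c : ℤ → ℂ} {ρ K : ℝ} (h : ExpDecay c ρ K) (hre : IsRealSeq c) (x : ℝ) :
    (fourierEval c x).re = (c 0).re + ∑' k : ℕ, (-2 * (c ((k + 1 : ℕ) : ℤ)).im * Real.sin (((k + 1 : ℕ) : ℝ) * x)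
        + 2 * (c ((k + 1 : ℕ) : ℤ)).re * Real.cos (((k + 1 : ℕ) : ℝ) * x)) := by
  rw [(hasSum_re_fourierEval_trig h hre x).tsum_eq]
  ring

/-- Under `ExpDecay` the folded coefficients have a finite first moment:
`Σ_k (k+1)(|α_k| + |β_k|) < ∞` (the hypothesis of `hilbertTransformCircle_tsum`; helper). [folklore] -/
private theorem summable_first_moment_of_expDecay {c : ℤ → ℂ} {ρ K : ℝ} (h : ExpDecay c ρ K) :
    Summable fun k : ℕ => ((k : ℝ) + 1) * (|(-2) * (c ((k + 1 : ℕ) : ℤ)).im| + |2 * (c ((k + 1 : ℕ) : ℤ)).re|) := by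
  have hN : Summable fun n : ℕ => ((n + 1 : ℕ) : ℝ) ^ 1 * Real.exp (-ρ * ((n + 1 : ℕ) : ℝ)) :=
    (summable_nat_add_iff (f := fun n : ℕ => (n : ℝ) ^ 1 * Real.exp (-ρ * (n : ℝ))) 1).mpr
      (Real.summable_pow_mul_exp_neg_nat_mul 1 h.1)
  refine Summable.of_nonneg_of_le (fun k => by positivity) (fun k => ?_) (hN.mul_left (4 * K))
  have hc : ‖c ((k + 1 : ℕ) : ℤ)‖ ≤ K * Real.exp (-ρ * ((k + 1 : ℕ) : ℝ)) := by
    have := h.2 ((k + 1 : ℕ) : ℤ)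
    rwa [Int.cast_natCast, Nat.abs_cast] at this
  have hre : |2 * (c ((k + 1 : ℕ) : ℤ)).re| ≤ 2 * ‖c ((k + 1 : ℕ) : ℤ)‖ := by
    rw [abs_mul, abs_two]
    exact mul_le_mul_of_nonneg_left (Complex.abs_re_le_norm _) (by norm_num)
  have him : |(-2) * (c ((k + 1 : ℕ) : ℤ)).im| ≤ 2 * ‖c ((k + 1 : ℕ) : ℤ)‖ := by
    rw [abs_mul, abs_neg, abs_two]
    exact mul_le_mul_of_nonneg_left (Complex.abs_im_le_norm _) (by norm_num)
  have hk : ((k : ℝ) + 1) = ((k + 1 : ℕ) : ℝ) := by push_cast; ring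
  rw [hk, pow_one]
  calc ((k + 1 : ℕ) : ℝ) * (|(-2) * (c ((k + 1 : ℕ) : ℤ)).im| + |2 * (c ((k + 1 : ℕ) : ℤ)).re|)
      ≤ ((k + 1 : ℕ) : ℝ) * (2 * ‖c ((k + 1 : ℕ) : ℤ)‖ + 2 * ‖c ((k + 1 : ℕ) : ℤ)‖) := by
        gcongr ((k + 1 : ℕ) : ℝ) * ?_
        exact add_le_add him hre
    _ = 4 * (((k + 1 : ℕ) : ℝ) * ‖c ((k + 1 : ℕ) : ℤ)‖) := by ring
    _ ≤ 4 * (((k + 1 : ℕ) : ℝ) * (K * Real.exp (-ρ * ((k + 1 : ℕ) : ℝ)))) := by gcongr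
    _ = 4 * K * (((k + 1 : ℕ) : ℝ) * Real.exp (-ρ * ((k + 1 : ℕ) : ℝ))) := by ring

/-! ### The multiplier is the analytic operator -/

/-- On positive modes the multiplier is `−i`: `hilbertCoeff c (k+1) = −i·c_{k+1}`. [cite: OkamotoSakajoWunsch2008, §1] -/
theorem hilbertCoeff_natSucc (c : ℤ → ℂ) (k : ℕ) :
    hilbertCoeff c ((k + 1 : ℕ) : ℤ) = -Complex.I * c ((k + 1 : ℕ) : ℤ) := by
  simp [hilbertCoeff, hilbertSymbol]

/-- **The Fourier multiplier `−i·sgn k` IS the periodic Hilbert transform** on exponentially decaying real Fourier series: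
for `ExpDecay c ρ K` and `IsRealSeq c`, the analytic p.v. operator `hilbertTransformCircle`
(`(2π)⁻¹ p.v. ∫_{−π}^{π} f(x′) cot((x − x′)/2) dx′`) applied to the real function `x ↦ Re Σ_k c_k e^{ikx}` is the real function
`x ↦ Re Σ_k (−i sgn k) c_k e^{ikx}`.
[cite: LushnikovSilantyevSiegel2021, §8 (`Ĥ^{2π}_k = −i·sign(k)` for the p.v. operator `ℋ^{2π}` of §7, eq. for `ℋ^{2π}`);
Grafakos2014, Ex. 4.1.4(c) (the conjugate function acts as `−i sgn k` on Fourier coefficients); OkamotoSakajoWunsch2008, §1] -/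
theorem hilbertTransformCircle_fourierEval_re {c : ℤ → ℂ} {ρ K : ℝ} (h : ExpDecay c ρ K) (hre : IsRealSeq c) (x : ℝ) :
    hilbertTransformCircle (fun y => (fourierEval c y).re) x = (fourierEval (hilbertCoeff c) x).re := by
  have hfun : (fun y => (fourierEval c y).re) = fun y => (c 0).re
      + ∑' k : ℕ, (-2 * (c ((k + 1 : ℕ) : ℤ)).im * Real.sin (((k + 1 : ℕ) : ℝ) * y)
        + 2 * (c ((k + 1 : ℕ) : ℤ)).re * Real.cos (((k + 1 : ℕ) : ℝ) * y)) :=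
    funext fun y => fourierEval_re_eq_const_add_tsum h hre y
  rw [hfun, hilbertTransformCircle_const_add,
    hilbertTransformCircle_tsum (α := fun k : ℕ => -2 * (c ((k + 1 : ℕ) : ℤ)).im)
      (β := fun k : ℕ => 2 * (c ((k + 1 : ℕ) : ℤ)).re) (summable_first_moment_of_expDecay h) x]
  have hH := hasSum_re_fourierEval_trig (expDecay_hilbertCoeff h) (isRealSeq_hilbertCoeff hre) x
  rw [hilbertCoeff_zero_mode, Complex.zero_re, sub_zero] at hH
  rw [← hH.tsum_eq]
  refine tsum_congr fun k => ?_
  rw [hilbertCoeff_natSucc]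
  simp only [Complex.mul_re, Complex.mul_im, Complex.neg_re, Complex.neg_im, Complex.I_re, Complex.I_im]
  ring

/-- The same as an identity of functions. [cite: LushnikovSilantyevSiegel2021, §8 (`Ĥ^{2π}_k = −i·sign(k)`); Grafakos2014, Ex. 4.1.4(c)] -/
theorem hilbertTransformCircle_fourierEval_re_eq {c : ℤ → ℂ} {ρ K : ℝ} (h : ExpDecay c ρ K) (hre : IsRealSeq c) :
    hilbertTransformCircle (fun y => (fourierEval c y).re) = fun x => (fourierEval (hilbertCoeff c) x).re :=
  funext fun x => hilbertTransformCircle_fourierEval_re h hre x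

/-! ### Consequences for the typed objects of `SeparableBlowup.lean` -/

/-- OSW's velocity `v = −(−∂ₓ²)^{−1/2} ω` is real for a real vorticity: on the coefficient side, `conj v(x) = v(x)` for a real
coefficient sequence (no summability needed). [cite: OkamotoSakajoWunsch2008, §1 (`v = −(−∂ₓ²)^{−1/2} ω`, `v_x = Hω`)] -/
theorem conj_velocityEval_of_isRealSeq {c : ℤ → ℂ} (hre : IsRealSeq c) (x : ℝ) :
    (starRingEnd ℂ) (velocityEval c x) = velocityEval c x := by
  unfold velocityEval
  rw [Complex.conj_tsum]
  calc ∑' k : ℤ, (starRingEnd ℂ) (hilbertCoeff c k * expChar k x / (Complex.I * (k : ℂ)))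
      = ∑' k : ℤ, hilbertCoeff c (-k) * expChar (-k) x / (Complex.I * (((-k : ℤ)) : ℂ)) := by
        congr 1
        ext k
        rw [map_div₀, map_mul, map_mul, conj_expChar, isRealSeq_hilbertCoeff hre k, Complex.conj_I, map_intCast]
        push_cast
        ring
    _ = ∑' k : ℤ, hilbertCoeff c k * expChar k x / (Complex.I * (k : ℂ)) :=
        (Equiv.neg ℤ).tsum_eq (fun k => hilbertCoeff c k * expChar k x / (Complex.I * (k : ℂ)))

/-- … hence `Im v(x) = 0` for a real coefficient sequence. [cite: OkamotoSakajoWunsch2008, §1 (`v = −(−∂ₓ²)^{−1/2} ω`)] -/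
theorem velocityEval_im_of_isRealSeq {c : ℤ → ℂ} (hre : IsRealSeq c) (x : ℝ) : (velocityEval c x).im = 0 :=
  Complex.conj_eq_iff_im.mp (conj_velocityEval_of_isRealSeq hre x)

/-- OSW's velocity `v = −(−∂ₓ²)^{−1/2} ω` is odd for an odd vorticity: `v(−x) = −v(x)` for an odd coefficient sequence
(no summability needed; so `v(0) = 0` and `v(x) = ∫₀ˣ Hω`). [cite: OkamotoSakajoWunsch2008, §1 (`v = −(−∂ₓ²)^{−1/2} ω`)] -/
theorem velocityEval_neg_of_isOddSeq {c : ℤ → ℂ} (hodd : IsOddSeq c) (x : ℝ) :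
    velocityEval c (-x) = -velocityEval c x := by
  unfold velocityEval
  calc ∑' k : ℤ, hilbertCoeff c k * expChar k (-x) / (Complex.I * (k : ℂ))
      = ∑' k : ℤ, hilbertCoeff c (-k) * expChar (-k) x / (Complex.I * (k : ℂ)) := by
        simp_rw [expChar_neg, hilbertCoeff_neg_of_isOddSeq hodd]
    _ = ∑' k : ℤ, hilbertCoeff c (-k) * expChar (-k) x / -(Complex.I * (((-k : ℤ)) : ℂ)) := by
        congr 1; ext k; push_cast; ring
    _ = ∑' k : ℤ, hilbertCoeff c k * expChar k x / -(Complex.I * (k : ℂ)) :=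
        (Equiv.neg ℤ).tsum_eq (fun k => hilbertCoeff c k * expChar k x / -(Complex.I * (k : ℂ)))
    _ = -∑' k : ℤ, hilbertCoeff c k * expChar k x / (Complex.I * (k : ℂ)) := by
        rw [← tsum_neg]; congr 1; ext k; rw [div_neg]

/-- The real vorticity/profile `f = Re ∘ fourierEval c` of an exponentially decaying coefficient sequence is differentiable with
derivative `f′ = Re ∘ fourierEval (derivCoeff c)` (the `ω_x` of the equation, read as a real function).
[cite: OkamotoSakajoWunsch2008, eq. (3) (the term `ω_x`)] -/
theorem hasDerivAt_fourierEval_re {c : ℤ → ℂ} {ρ K : ℝ} (h : ExpDecay c ρ K) (x : ℝ) :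
    HasDerivAt (fun y => (fourierEval c y).re) ((fourierEval (derivCoeff c) x).re) x := by
  have hd := Complex.reCLM.hasFDerivAt.comp_hasDerivAt x (hasDerivAt_fourierEval h x)
  simpa [Function.comp_def] using hd

/-- The real velocity `g = Re ∘ velocityEval c` is a primitive of the GENUINE Hilbert transform of the real profile:
`g′ = H[Re ∘ fourierEval c]` (OSW's `v_x = Hω` [cite: OkamotoSakajoWunsch2008, eq. (3)] with the analytic operator). -/
theorem hasDerivAt_velocityEval_re {c : ℤ → ℂ} {ρ K : ℝ} (h : ExpDecay c ρ K) (hre : IsRealSeq c) (x : ℝ) :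
    HasDerivAt (fun y => (velocityEval c y).re) (hilbertTransformCircle (fun y => (fourierEval c y).re) x) x := by
  rw [hilbertTransformCircle_fourierEval_re h hre x]
  have hd := Complex.reCLM.hasFDerivAt.comp_hasDerivAt x (hasDerivAt_velocityEval h x)
  simpa [Function.comp_def] using hd

/-- Real part of the Fourier-side right-hand side `−a·v·ω_x + ω·Hω` when all four series are real (helper). [folklore] -/
private theorem re_rhs_of_isRealSeq {c : ℤ → ℂ} (hre : IsRealSeq c) (a x : ℝ) :
    (-(a : ℂ) * velocityEval c x * fourierEval (derivCoeff c) x + fourierEval c x * fourierEval (hilbertCoeff c) x).re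
      = -a * (velocityEval c x).re * (fourierEval (derivCoeff c) x).re
        + (fourierEval c x).re * (fourierEval (hilbertCoeff c) x).re := by
  have h1 : (velocityEval c x).im = 0 := velocityEval_im_of_isRealSeq hre x
  have h2 : (fourierEval (derivCoeff c) x).im = 0 := fourierEval_im_of_isRealSeq (isRealSeq_derivCoeff hre) x
  have h3 : (fourierEval c x).im = 0 := fourierEval_im_of_isRealSeq hre x
  have h4 : (fourierEval (hilbertCoeff c) x).im = 0 := fourierEval_im_of_isRealSeq (isRealSeq_hilbertCoeff hre) x
  simp only [Complex.add_re, Complex.mul_re, Complex.mul_im, Complex.neg_re, Complex.neg_im, Complex.ofReal_re,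
    Complex.ofReal_im, h1, h2, h3, h4]
  ring

/-- **The profile equation (T1) with the analytic Hilbert transform.** If `c` is an exponentially decaying real coefficient
sequence with `IsSeparableProfile a c` (the Fourier-side transcription of [cite: LushnikovSilantyevSiegel2021, §11]), then the real
profile `f = Re ∘ fourierEval c` satisfies `f = −a·g·f′ + f·Hf` pointwise with `H = hilbertTransformCircle`, `f′ = Re ∘ fourierEval (derivCoeff c)`
(its derivative, `hasDerivAt_fourierEval_re`) and `g = Re ∘ velocityEval c` (a primitive of `Hf`, `hasDerivAt_velocityEval_re`). -/
theorem profileEq_re_of_isSeparableProfile {a : ℝ} {c : ℤ → ℂ} {ρ K : ℝ} (h : ExpDecay c ρ K) (hre : IsRealSeq c)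
    (hT1 : IsSeparableProfile a c) (x : ℝ) :
    (fourierEval c x).re = -a * (velocityEval c x).re * (fourierEval (derivCoeff c) x).re
      + (fourierEval c x).re * hilbertTransformCircle (fun y => (fourierEval c y).re) x := by
  rw [hilbertTransformCircle_fourierEval_re h hre x, ← re_rhs_of_isRealSeq hre a x]
  exact congrArg Complex.re (hT1 x)

/-- **Eq. (3) with the analytic Hilbert transform.** A typed `IsClassicalSolution a C T` of [cite: OkamotoSakajoWunsch2008, eq. (3)]
is a classical solution in the real sense: with `ω(x,t) = Re Σ_k C_t(k) e^{ikx}`, `ω_x = Re ∘ fourierEval (derivCoeff C_t)`,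
`v = Re ∘ velocityEval C_t`, for every `x` and every `t < T` the time derivative of `t ↦ ω(x,t)` exists and equals
`−a·v·ω_x + ω·H[ω(·,t)](x)` where `H = hilbertTransformCircle` is the p.v. cot-kernel operator. -/
theorem hasDerivAt_re_of_isClassicalSolution {a : ℝ} {C : ℝ → ℤ → ℂ} {T : ℝ} (hsol : IsClassicalSolution a C T)
    (x t : ℝ) (ht : t < T) :
    HasDerivAt (fun s : ℝ => (fourierEval (C s) x).re)
      (-a * (velocityEval (C t) x).re * (fourierEval (derivCoeff (C t)) x).re
        + (fourierEval (C t) x).re * hilbertTransformCircle (fun y => (fourierEval (C t) y).re) x) t := by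
  obtain ⟨⟨ρ, K, hdec⟩, hre⟩ := hsol.1 t ht
  have hd := Complex.reCLM.hasFDerivAt.comp_hasDerivAt t (hsol.2 x t ht)
  rw [hilbertTransformCircle_fourierEval_re hdec hre x, ← re_rhs_of_isRealSeq hre a x]
  simpa [Function.comp_def] using hd

/-- **The typed target, read with the analytic operator.** `AnalyticSeparableProfile P lo hi` (the Fourier-side target of cell
pub-oswblow) provides a parameter `a ∈ [lo, hi]` and REAL functions `f, f′, g : ℝ → ℝ` — `f` odd, `2π`-periodic, negative on
`(0, π)`, `C¹` with `f′` its derivative, `g` odd with `g(0) = 0` and `g′ = Hf` — solving the separable-blow-up profile equation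
`f = −a·g·f′ + f·Hf` of [cite: LushnikovSilantyevSiegel2021, §11] with `H = hilbertTransformCircle`, with vanishing order exactly `P`
at the antipode. This is the hypotheses shape of the E2 analytic step (`OSWAprioriAnalyticStep.origin_identity`). Nothing is
asserted: the target stays a hypothesis. -/
theorem analyticSeparableProfile_real {P : ℕ} {lo hi : ℝ} (hA : AnalyticSeparableProfile P lo hi) :
    ∃ a : ℝ, lo ≤ a ∧ a ≤ hi ∧ ∃ f f' g : ℝ → ℝ,
      (∀ x, HasDerivAt f (f' x) x) ∧ (∀ x, HasDerivAt g (hilbertTransformCircle f x) x) ∧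
      (∀ x, f (-x) = -f x) ∧ (∀ x, f (x + 2 * π) = f x) ∧ (∀ x, g (-x) = -g x) ∧ g 0 = 0 ∧
      (∀ x ∈ Ioo (0 : ℝ) π, f x < 0) ∧
      (∀ x, f x = -a * g x * f' x + f x * hilbertTransformCircle f x) ∧
      ∃ κ : ℝ, κ ≠ 0 ∧ Tendsto (fun y : ℝ => f (π + y) / y ^ P) (𝓝[≠] 0) (𝓝 κ) := by
  obtain ⟨a, hlo, hhi, c, ρ, K, hdec, hre, hodd, hneg, hT1, κ, hκ, hlim⟩ := hA
  refine ⟨a, hlo, hhi, fun x => (fourierEval c x).re, fun x => (fourierEval (derivCoeff c) x).re,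
    fun x => (velocityEval c x).re, fun x => hasDerivAt_fourierEval_re hdec x,
    fun x => hasDerivAt_velocityEval_re hdec hre x, fun x => ?_, fun x => ?_, fun x => ?_, ?_,
    fun x hx => hneg x hx.1 hx.2, fun x => profileEq_re_of_isSeparableProfile hdec hre hT1 x, κ, hκ, hlim⟩
  · simp only [fourierEval_neg_of_isOddSeq hodd, Complex.neg_re]
  · simp only [fourierEval_add_two_pi]
  · simp only [velocityEval_neg_of_isOddSeq hodd, Complex.neg_re]
  · have h0 := velocityEval_neg_of_isOddSeq hodd 0
    rw [neg_zero] at h0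
    have : velocityEval c 0 = 0 := by
      have h2 : (2 : ℂ) * velocityEval c 0 = 0 := by linear_combination h0
      simpa using h2
    simp [this]

end Literature.Analysis.FluidPDE.OkamotoSakajoWunsch2008

end
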